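import Literature.MathematicalPhysics.QuantumFieldTheory.Balaban1983to89.B7Prop2Explicit
import HarnessLib

/-!
# Line H (`BirthV10.stub_halvingStep`, stmt-QuantumFields-19200) — σ-EDITION (LEAD-H ★w5-19200 g7 WORD 24): THE θ-BUDGET OF THE (b)-ROW CLOSURE `hStokesL_holds`
# (pen (i), second half; sibling of `…HStokesRowClosureWindows`)

Cell `ym3-torus` (HUMAN RULING D-0037: YM₃ on T³ is ladder rung R3 — NOT d = 4, NOT infinite volume, NOT a mass gap, NOT the Clay problem), width seat
`ym3-torus-px20` gen 5.  `--supports stmt-QuantumFields-19200 --as helper`; THEOREMS ONLY (0 `def`, 0 `sorry`); count-neutral; nothing here claims the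
(b)-row, the stub, the crux or the gap.

WHAT (the located seam of `LOCATE-THETA-BUDGET-px20g5.md`, 19200 evidence #47, and its cure in the σ-letter).  Letters: `n := ρ′+M′+1`, `s := n·ε₀`,
`α₁ = 198·s + 27·s∕(L·B₀)`, `cstar = 5·d·L·B₀·(ε₀+α₁)`, `X₀ := 1+B₀+B₀⁻¹`, master window `10^21·L^6·X₀²·s ≤ 1` (✓`HalvingHStokesRowClosureWindows.master_of_hw`).
* `theta_budget` — with the closure's choice `4 ≤ Cθ`, `Cθ·n ≤ Cr`, `Cr·ε₁ ≤ ε₀` and ANY `θG ≤ 38·s`: the door's rows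
  `2·(d(M′+ρ′)(d(M′−1+4ρ′)(3ε₁+44R)+4R)) + 3θG ≤ d·L·α₁∕8` (`54·s + 4·s + 114·s ≤ 222·s`) and `θG ≤ 1∕8`;
* `hstar_le`, `csigma_le`, `wstar_le` — the (F-h)∕(F-ω) adapters' top values in the σ-letter: `h⋆ ≤ 261·L²·s`, `cσ ≤ 2·(L·cstar) ≤ 6240·L²·X₀·s`,
  `w⋆ ≤ 37·10^5·L^3·X₀·s`;
* `thetaG_le_of_sigma` — hence `θG := 3·(23040·h⋆·w⋆ + 4800·w⋆²) ≤ s` (= `O(s²)`: the cure's §3), with the E-windows `160·(3b)+9900w⋆+16128h⋆ ≤ 1`,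
  `3b ≤ 1∕200`, `h⋆ ≤ 1∕64`, `w⋆ ≤ 1∕600` of ✓`HalvingEffGaugeLevelSeq.exists_levelSeq_rows_L` ∕ ✓p700686 `hG_of_rows` thrown in.
HONEST SCOPE.  Arithmetic only; no lattice object appears; the (b)-row, `hG`, the ω-row are NOT touched here.

References: T. Bałaban, CMP **98** (1985) 17–51 [Balaban1985Averaging] ((84)–(86) pp.30–31, Prop. 4 (134)–(144) pp.38–40); CMP **99** (1985) 75–102
[Balaban1985RegularSpaces] ((1.29) p.81, Prop. 3 (1.42) p.83, Thm 4 p.88).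
-/

set_option autoImplicit false

namespace Summit.QuantumFields.YangMills.Theorems.HalvingHStokesRowClosureTheta

/-! ## §3 The θ-budget at `θb := d·L·α₁∕8` -/

/-- §3 ★★★ **THE θ-BUDGET** (the located seam, `LOCATE-THETA-BUDGET-px20g5.md` §3).  Letters: `d = 3`, `L ≥ 3`, `0 < B₀`, `n := ρ′+M′+1` (reals `M′ ≥ 1`, `ρ′ ≥ 0`),
`s := n·ε₀`, `α₁ = 198·s + 27·s∕(L·B₀)`; the closure's choice `4 ≤ Cθ` with the prefix rows `Cθ·n ≤ Cr`, `Cr·ε₁ ≤ ε₀`, `0 < ε₁`; the remainder `R ≥ 0` with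
`n²·R ≤ s∕10^9` (✓`R_small`); and ANY effective-gauge constant `θG ≤ 38·s`.  Then the door's rows `hθb` and `hθG1` hold:
`2·(d(M′+ρ′)·(d(M′−1+4ρ′)·(3ε₁ + 44R) + 4R)) + 3·θG ≤ d·L·α₁∕8` and `θG ≤ 1∕8`. [cite: Balaban1985RegularSpaces, (1.42) p.83; Balaban1985Averaging, (84)-(86) pp.30-31] -/
theorem theta_budget {d L B₀ M' ρ' ε₀ ε₁ Cr Cθ α₁ R θG : ℝ} (hd : d = 3) (hL : 3 ≤ L) (hB₀ : 0 < B₀)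
    (hM' : 1 ≤ M') (hρ' : 0 ≤ ρ') (hε₀ : 0 ≤ ε₀) (hε₁ : 0 < ε₁) (hCrε : Cr * ε₁ ≤ ε₀) (hCθ4 : 4 ≤ Cθ) (hCθ : Cθ * (ρ' + M' + 1) ≤ Cr)
    (hα₁ : α₁ = 198 * ((ρ' + M' + 1) * ε₀) + 27 * ((ρ' + M' + 1) * ε₀) / (L * B₀))
    (hR0 : 0 ≤ R) (hn2R : (ρ' + M' + 1) ^ 2 * R ≤ (ρ' + M' + 1) * ε₀ / 10 ^ 9)
    (hS : (10 : ℝ) ^ 21 * L ^ 6 * ((ρ' + M' + 1) * ε₀) ≤ 1)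
    (hθG : θG ≤ 38 * ((ρ' + M' + 1) * ε₀)) :
    2 * (d * (M' + ρ') * (d * (M' - 1 + 4 * ρ') * (3 * ε₁ + 44 * R) + 4 * R)) + 3 * θG ≤ d * L * α₁ / 8 ∧ θG ≤ 1 / 8 := by
  subst hd
  set n : ℝ := ρ' + M' + 1 with hn
  set s : ℝ := n * ε₀ with hs
  have hn1 : 1 ≤ n := by rw [hn]; linarith only [hM', hρ']
  have hn0 : 0 ≤ n := by linarith only [hn1]
  have hs0 : 0 ≤ s := by rw [hs]; positivity
  have hL1 : 1 ≤ L := by linarith only [hL]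
  -- the RHS: `3Lα₁/8 ≥ 222.75·s`
  have hα₁lo : 198 * s ≤ α₁ := by
    rw [hα₁]; have : 0 ≤ 27 * s / (L * B₀) := by positivity
    linarith only [this]
  have hRHS : 222 * s ≤ 3 * L * α₁ / 8 := by
    have h1 : 3 * 3 * (198 * s) ≤ 3 * L * α₁ := by
      have := mul_le_mul hL hα₁lo (by positivity) (by positivity); linarith only [this]
    linarith only [h1, hs0]
  -- term 1: the ε₁-summand, `54(M′+ρ′)(M′−1+4ρ′)ε₁ ≤ 216·n²·ε₁ ≤ 54·s` (via `4n·ε₁ ≤ Cθ·n·ε₁ ≤ Cr·ε₁ ≤ ε₀`)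
  have hA1 : M' + ρ' ≤ n := by rw [hn]; linarith only []
  have hA0 : 0 ≤ M' + ρ' := by linarith only [hM', hρ']
  have hB1 : M' - 1 + 4 * ρ' ≤ 4 * n := by rw [hn]; linarith only [hM', hρ']
  have hB0 : 0 ≤ M' - 1 + 4 * ρ' := by linarith only [hM', hρ']
  have hnε₁ : 4 * n * ε₁ ≤ ε₀ := by
    have h1 : 4 * n ≤ Cr := by nlinarith only [hCθ4, hCθ, hn0]
    have h2 := mul_le_mul_of_nonneg_right h1 hε₁.le
    linarith only [h2, hCrε]
  have hT1 : 2 * (3 * (M' + ρ') * (3 * (M' - 1 + 4 * ρ') * (3 * ε₁))) ≤ 54 * s := by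
    have h1 : (M' + ρ') * (M' - 1 + 4 * ρ') ≤ n * (4 * n) := mul_le_mul hA1 hB1 hB0 hn0
    have h2 : (M' + ρ') * (M' - 1 + 4 * ρ') * ε₁ ≤ n * (4 * n) * ε₁ := mul_le_mul_of_nonneg_right h1 hε₁.le
    have h3 : n * (4 * n) * ε₁ = n * (4 * n * ε₁) := by ring
    have h4 : n * (4 * n * ε₁) ≤ n * ε₀ := mul_le_mul_of_nonneg_left hnε₁ hn0
    rw [hs]; nlinarith only [h2, h3, h4]
  -- term 2: the R-summands, `≤ 3192·n²·R ≤ 4·s`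
  have hT2 : 2 * (3 * (M' + ρ') * (3 * (M' - 1 + 4 * ρ') * (44 * R) + 4 * R)) ≤ 4 * s := by
    have h1 : 3 * (M' - 1 + 4 * ρ') * (44 * R) + 4 * R ≤ 532 * n * R := by
      have := mul_le_mul_of_nonneg_right hB1 (by positivity : 0 ≤ 44 * R)
      have h4 : 4 * R ≤ 4 * n * R := by nlinarith only [hn1, hR0]
      nlinarith only [this, h4]
    have h2 : (M' + ρ') * (3 * (M' - 1 + 4 * ρ') * (44 * R) + 4 * R) ≤ n * (532 * n * R) :=
      mul_le_mul hA1 h1 (by positivity) hn0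
    have h3 : n * (532 * n * R) = 532 * (n ^ 2 * R) := by ring
    have h5 : n ^ 2 * R ≤ s / 10 ^ 9 := by rw [hs]; exact hn2R
    have h6 : s / 10 ^ 9 ≤ s / 798 := div_le_div_of_nonneg_left hs0 (by norm_num) (by norm_num)
    nlinarith only [h2, h3, h5, h6, hs0]
  -- term 3
  have hT3 : 3 * θG ≤ 114 * s := by rw [hs]; linarith only [hθG]
  have hsplit : 2 * (3 * (M' + ρ') * (3 * (M' - 1 + 4 * ρ') * (3 * ε₁ + 44 * R) + 4 * R)) =
      2 * (3 * (M' + ρ') * (3 * (M' - 1 + 4 * ρ') * (3 * ε₁))) + 2 * (3 * (M' + ρ') * (3 * (M' - 1 + 4 * ρ') * (44 * R) + 4 * R)) := by ring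
  refine ⟨?_, ?_⟩
  · rw [hsplit]; linarith only [hT1, hT2, hT3, hRHS, hs0]
  · -- θG ≤ 38 s ≤ 1/8 from the master window (`s ≤ 10⁻²¹`)
    have hL6 : 1 ≤ L ^ 6 := one_le_pow₀ hL1
    have hs1 : 10 ^ 21 * s ≤ 1 := by
      have : 10 ^ 21 * s ≤ 10 ^ 21 * L ^ 6 * s := by nlinarith only [hL6, hs0]
      rw [hs] at this ⊢; linarith only [this, hS]
    rw [hs] at hs1; linarith only [hθG, hs1]

/-- §3 ★ **`h⋆` IN THE MASTER WINDOW** — the (F-h) adapter's top value `h⋆ = 4ℓ′·(dd·(4ε₀) + (102∕100)·R)` (✓p700741 `stairSize_closedForm_le_mul_levelRatio`)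
with `ℓ′ ≤ 5L`, `dd ≤ 3L`, `ε₀ ≤ s`, `R ≤ s`: `h⋆ ≤ 261·L²·s`. [cite: Balaban1985Averaging, Prop. 4 (134)-(135) pp.38-39] -/
theorem hstar_le {L ℓ' dd ε₀ R s : ℝ} (hL : 1 ≤ L) (hℓ' : ℓ' ≤ 5 * L) (hdd0 : 0 ≤ dd) (hdd : dd ≤ 3 * L)
    (hε₀ : 0 ≤ ε₀) (hεs : ε₀ ≤ s) (hR0 : 0 ≤ R) (hRs : R ≤ s) :
    4 * ℓ' * (dd * (4 * ε₀) + 102 / 100 * R) ≤ 261 * L ^ 2 * s := by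
  have hs0 : 0 ≤ s := hε₀.trans hεs
  have h1 : dd * (4 * ε₀) + 102 / 100 * R ≤ 3 * L * (4 * s) + 102 / 100 * s := by
    have := mul_le_mul hdd (mul_le_mul_of_nonneg_left hεs (by norm_num : (0:ℝ) ≤ 4)) (by positivity) (by positivity)
    linarith only [this, hRs]
  have h2 : 3 * L * (4 * s) + 102 / 100 * s ≤ 1305 / 100 * L * s := by nlinarith only [hL, hs0]
  have h3 := mul_le_mul hℓ' (h1.trans h2) (by positivity) (by positivity)
  have h4 : 4 * ℓ' * (dd * (4 * ε₀) + 102 / 100 * R) = 4 * (ℓ' * (dd * (4 * ε₀) + 102 / 100 * R)) := by ring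
  rw [h4]; nlinarith only [h3, hL, hs0]

/-- §3 ★ **THE σ-LETTER's CHART BOUND**: `cσ ≤ 2·(L·cstar)`, `cstar = 5·d·L·B₀·(ε₀+α₁)`, `d = 3`, `α₁ = 198s + 27s∕(LB₀)`, `ε₀ ≤ s`, `L ≥ 3`
⇒ `cσ ≤ 6240·L²·(1+B₀+B₀⁻¹)·s`. [cite: Balaban1985RegularSpaces, (1.42) p.83, Thm 4 p.88] -/
theorem csigma_le {d L B₀ ε₀ s α₁ cstar cσ : ℝ} (hd : d = 3) (hL : 3 ≤ L) (hB₀ : 0 < B₀) (hε₀ : 0 ≤ ε₀) (hεs : ε₀ ≤ s)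
    (hα₁ : α₁ = 198 * s + 27 * s / (L * B₀)) (hcstar : cstar = 5 * d * L * B₀ * (ε₀ + α₁)) (hcσ : cσ ≤ 2 * (L * cstar)) :
    cσ ≤ 6240 * L ^ 2 * (1 + B₀ + B₀⁻¹) * s := by
  subst hd
  have hs0 : 0 ≤ s := hε₀.trans hεs
  have hL0 : 0 < L := by linarith only [hL]
  have hBα : B₀ * (ε₀ + α₁) ≤ (199 * B₀ + 9) * s := by
    have e : B₀ * (ε₀ + α₁) = B₀ * ε₀ + 198 * B₀ * s + 27 * s / L := by
      rw [hα₁]; field_simp; ring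
    have h27 : 27 * s / L ≤ 9 * s := by
      rw [div_le_iff₀ hL0]; nlinarith only [hL, hs0]
    have hBε : B₀ * ε₀ ≤ B₀ * s := mul_le_mul_of_nonneg_left hεs hB₀.le
    rw [e]; linarith only [h27, hBε]
  have hX : 199 * B₀ + 9 ≤ 208 * (1 + B₀ + B₀⁻¹) := by
    have := (inv_pos.2 hB₀).le; nlinarith only [this, hB₀.le]
  have h1 : cstar ≤ 15 * L * ((199 * B₀ + 9) * s) := by
    rw [hcstar]
    have e : 5 * 3 * L * B₀ * (ε₀ + α₁) = 15 * L * (B₀ * (ε₀ + α₁)) := by ring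
    rw [e]; exact mul_le_mul_of_nonneg_left hBα (by positivity)
  have h2 : 15 * L * ((199 * B₀ + 9) * s) ≤ 15 * L * (208 * (1 + B₀ + B₀⁻¹) * s) := by
    have := mul_le_mul_of_nonneg_right hX hs0
    exact mul_le_mul_of_nonneg_left this (by positivity)
  calc cσ ≤ 2 * (L * cstar) := hcσ
    _ ≤ 2 * (L * (15 * L * (208 * (1 + B₀ + B₀⁻¹) * s))) := by gcongr; exact h1.trans h2
    _ = 6240 * L ^ 2 * (1 + B₀ + B₀⁻¹) * s := by ring

/-- §3 ★ **`w⋆` IN THE MASTER WINDOW** — the (F-ω) adapter's top value `w⋆ = x⋆ + 2a⋆ + a⋆² + (2a⋆ + a⋆²)·x⋆`, `x⋆ = D·(C·(2ε₀) + cσ)`, `a⋆ = G·cσ`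
(✓p700741 `omega_closedForm_le_mul_levelRatio`, `cmax := cσ`) with `D ≤ 3L`, `C ≤ 7168`, `G ≤ 192`, `ε₀ ≤ s`, `cσ ≤ 6240·L²·X₀·s`, `X₀ ≥ 1` and the master
window `10^21·L^6·X₀²·s ≤ 1`: `w⋆ ≤ 37·10^5·L^3·X₀·s`. [cite: Balaban1985Averaging, (84)-(85) pp.30-31, (99) p.32, (163) p.42] -/
theorem wstar_le {L D C G ε₀ s cσ X₀ : ℝ} (hL : 3 ≤ L) (hD0 : 0 ≤ D) (hD : D ≤ 3 * L) (hC0 : 0 ≤ C) (hC : C ≤ 7168) (hG0 : 0 ≤ G) (hG : G ≤ 192)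
    (hε₀ : 0 ≤ ε₀) (hεs : ε₀ ≤ s) (hcσ0 : 0 ≤ cσ) (hcσ : cσ ≤ 6240 * L ^ 2 * X₀ * s) (hX : 1 ≤ X₀)
    (hSX : (10 : ℝ) ^ 21 * L ^ 6 * X₀ ^ 2 * s ≤ 1) :
    D * (C * (2 * ε₀) + cσ) + 2 * (G * cσ) + (G * cσ) ^ 2 + (2 * (G * cσ) + (G * cσ) ^ 2) * (D * (C * (2 * ε₀) + cσ)) ≤
      37 * 10 ^ 5 * L ^ 3 * X₀ * s := by
  have hs0 : 0 ≤ s := hε₀.trans hεs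
  have hL1 : 1 ≤ L := by linarith only [hL]
  have hX0 : 0 ≤ X₀ := by linarith only [hX]
  set v : ℝ := G * cσ with hv
  set u : ℝ := D * (C * (2 * ε₀) + cσ) with hu
  have hv0 : 0 ≤ v := by rw [hv]; positivity
  have hu0 : 0 ≤ u := by rw [hu]; positivity
  -- sizes in the letter `t := L²·X₀·s` (`L·t ≤ 10⁻²¹` by the master window)
  set t : ℝ := L ^ 2 * X₀ * s with ht
  have ht0 : 0 ≤ t := by rw [ht]; positivity
  have hLt : 10 ^ 21 * (L * t) ≤ 1 := by
    have h1 : L * t ≤ L ^ 6 * X₀ ^ 2 * s := by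
      rw [ht]
      have hL3 : L ^ 3 ≤ L ^ 6 := pow_le_pow_right₀ hL1 (by norm_num)
      have hX2 : X₀ ≤ X₀ ^ 2 := by nlinarith only [hX]
      calc L * (L ^ 2 * X₀ * s) = L ^ 3 * X₀ * s := by ring
        _ ≤ L ^ 6 * X₀ ^ 2 * s := by gcongr
    linarith only [h1, hSX, mul_le_mul_of_nonneg_left h1 (by norm_num : (0:ℝ) ≤ 10 ^ 21)]
  have ht1 : t ≤ 1 / 10 ^ 21 := by
    rw [le_div_iff₀ (by norm_num)]
    have : t ≤ L * t := le_mul_of_one_le_left ht0 hL1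
    nlinarith only [this, hLt]
  have hvb : v ≤ 1198080 * t := by
    rw [hv, ht]
    calc G * cσ ≤ 192 * (6240 * L ^ 2 * X₀ * s) := mul_le_mul hG hcσ hcσ0 (by norm_num)
      _ = 1198080 * (L ^ 2 * X₀ * s) := by ring
  have hεt : ε₀ ≤ t := by
    rw [ht]
    have h1 : s ≤ L ^ 2 * X₀ * s := by
      have : 1 ≤ L ^ 2 * X₀ := one_le_mul_of_one_le_of_one_le (one_le_pow₀ hL1) hX
      exact le_mul_of_one_le_left hs0 this
    exact hεs.trans h1
  have hub : u ≤ 61728 * (L * t) := by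
    rw [hu]
    have h1 : C * (2 * ε₀) + cσ ≤ 7168 * (2 * t) + 6240 * t := by
      have := mul_le_mul hC (mul_le_mul_of_nonneg_left hεt (by norm_num : (0:ℝ) ≤ 2)) (by positivity) (by norm_num)
      have h2 : cσ ≤ 6240 * t := by rw [ht]; linarith only [hcσ]
      linarith only [this, h2]
    have h3 : 7168 * (2 * t) + 6240 * t = 20576 * t := by ring
    rw [h3] at h1
    calc D * (C * (2 * ε₀) + cσ) ≤ 3 * L * (20576 * t) := mul_le_mul hD h1 (by positivity) (by positivity)
      _ = 61728 * (L * t) := by ring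
  -- the quadratic pieces are negligible: `v ≤ 10⁻¹⁵`, so `v² ≤ v`, `(2v+v²)u ≤ 3v·u ≤ u`
  have hv1 : v ≤ 1 / 300 := by nlinarith only [hvb, ht1, ht0]
  have hv2 : v ^ 2 ≤ v / 100 := by nlinarith only [hv0, hv1]
  have hcross : (2 * v + v ^ 2) * u ≤ u / 100 := by nlinarith only [hv0, hv1, hv2, hu0]
  have hLt' : L * t = L ^ 3 * X₀ * s := by rw [ht]; ring
  have htL : t ≤ L * t := le_mul_of_one_le_left ht0 hL1
  have hq0 : 0 ≤ L ^ 3 * X₀ * s := by positivity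
  calc u + 2 * v + v ^ 2 + (2 * v + v ^ 2) * u ≤ u + 2 * v + v / 100 + u / 100 := by linarith only [hv2, hcross]
    _ ≤ 101 / 100 * (61728 * (L * t)) + 201 / 100 * (1198080 * (L * t)) := by linarith only [hub, hvb, htL, hv0]
    _ ≤ 37 * 10 ^ 5 * L ^ 3 * X₀ * s := by rw [hLt']; linarith only [hq0]

/-- §3 ★★ **`θG = O(s²)` IN THE σ-LETTER**: with `h⋆ ≤ 261·L²·s`, `w⋆ ≤ 37·10^5·L^3·X₀·s` (✓`hstar_le`, ✓`wstar_le`) and the master window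
`10^21·L^6·X₀²·s ≤ 1`, the k-uniform effective-gauge constant of ✓`HalvingEffGaugeLevelSeq.exists_levelSeq_rows_L` satisfies
`3·(23040·h⋆·w⋆ + 4800·w⋆²) ≤ s` (≤ `38·s`, the input of ✓`theta_budget`), together with its two E-windows `160·(3b) + 9900·w⋆ + 16128·h⋆ ≤ 1`, `3b ≤ 1∕200`
and the uniform rows `h⋆ ≤ 1∕64`, `w⋆ ≤ 1∕600`. [cite: Balaban1985Averaging, Prop. 4 (139)-(144) pp.39-40, (84)-(86) pp.30-31] -/
theorem thetaG_le_of_sigma {L hs ws X₀ s : ℝ} (hL : 3 ≤ L) (hX : 1 ≤ X₀) (hs0 : 0 ≤ s) (hws0 : 0 ≤ ws)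
    (hhs : hs ≤ 261 * L ^ 2 * s) (hws : ws ≤ 37 * 10 ^ 5 * L ^ 3 * X₀ * s) (hSX : (10 : ℝ) ^ 21 * L ^ 6 * X₀ ^ 2 * s ≤ 1) :
    3 * (23040 * hs * ws + 4800 * ws ^ 2) ≤ s ∧ 3 * (23040 * hs * ws + 4800 * ws ^ 2) ≤ 38 * s ∧
      160 * (3 * (23040 * hs * ws + 4800 * ws ^ 2)) + 9900 * ws + 16128 * hs ≤ 1 ∧ 3 * (23040 * hs * ws + 4800 * ws ^ 2) ≤ 1 / 200 ∧
      hs ≤ 1 / 64 ∧ ws ≤ 1 / 600 := by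
  have hL1 : 1 ≤ L := by linarith only [hL]
  have hX0 : 0 ≤ X₀ := by linarith only [hX]
  -- the letter `q := L³·X₀·s` with `10^21·q ≤ 1`… via `L³X₀ ≤ L⁶X₀²`
  set q : ℝ := L ^ 3 * X₀ * s with hq
  have hq0 : 0 ≤ q := by rw [hq]; positivity
  have hq1 : 10 ^ 21 * q ≤ 1 := by
    have h1 : q ≤ L ^ 6 * X₀ ^ 2 * s := by
      rw [hq]
      have hL36 : L ^ 3 ≤ L ^ 6 := pow_le_pow_right₀ hL1 (by norm_num)
      have hX2 : X₀ ≤ X₀ ^ 2 := by nlinarith only [hX]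
      gcongr
    linarith only [mul_le_mul_of_nonneg_left h1 (by norm_num : (0:ℝ) ≤ 10 ^ 21), hSX]
  have hsq : s ≤ q := by
    rw [hq]
    have : 1 ≤ L ^ 3 * X₀ := one_le_mul_of_one_le_of_one_le (one_le_pow₀ hL1) hX
    exact le_mul_of_one_le_left hs0 this
  have hhsq : hs ≤ 261 * q := by
    have : L ^ 2 * s ≤ q := by
      rw [hq]
      have hL23 : L ^ 2 ≤ L ^ 3 := pow_le_pow_right₀ hL1 (by norm_num)
      calc L ^ 2 * s = L ^ 2 * 1 * s := by ring
        _ ≤ L ^ 3 * X₀ * s := by gcongr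
    linarith only [hhs, this]
  have hwsq : ws ≤ 37 * 10 ^ 5 * q := by rw [hq]; linarith only [hws]
  -- products
  have hP1 : hs * ws ≤ 261 * q * (37 * 10 ^ 5 * q) := mul_le_mul hhsq hwsq hws0 (by positivity)
  have hP2 : ws ^ 2 ≤ (37 * 10 ^ 5 * q) ^ 2 := pow_le_pow_left₀ hws0 hwsq 2
  have hqq : q * q ≤ s / 10 ^ 21 := by
    have e : q * q = (L ^ 6 * X₀ ^ 2 * s) * s := by rw [hq]; ring
    rw [e, le_div_iff₀ (by norm_num)]
    nlinarith only [hSX, hs0]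
  have hq1' : q ≤ 1 / 10 ^ 21 := by rw [le_div_iff₀ (by norm_num)]; linarith only [hq1]
  have hmain : 3 * (23040 * hs * ws + 4800 * ws ^ 2) ≤ s / 5000 := by
    have e : 3 * (23040 * (261 * q * (37 * 10 ^ 5 * q)) + 4800 * (37 * 10 ^ 5 * q) ^ 2) =
        (3 * (23040 * 261 * 37 * 10 ^ 5 + 4800 * (37 * 10 ^ 5) ^ 2)) * (q * q) := by ring
    have hc : (3 * (23040 * 261 * 37 * 10 ^ 5 + 4800 * (37 * 10 ^ 5) ^ 2) : ℝ) ≤ 2 * 10 ^ 17 := by norm_num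
    have h1 : 3 * (23040 * hs * ws + 4800 * ws ^ 2) ≤ 3 * (23040 * (261 * q * (37 * 10 ^ 5 * q)) + 4800 * (37 * 10 ^ 5 * q) ^ 2) := by
      nlinarith only [hP1, hP2]
    rw [e] at h1
    have h2 : (3 * (23040 * 261 * 37 * 10 ^ 5 + 4800 * (37 * 10 ^ 5) ^ 2) : ℝ) * (q * q) ≤ 2 * 10 ^ 17 * (s / 10 ^ 21) :=
      mul_le_mul hc hqq (by positivity) (by norm_num)
    have h3 : (2 : ℝ) * 10 ^ 17 * (s / 10 ^ 21) = s / 5000 := by ring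
    linarith only [h1, h2, h3]
  have hθs : 3 * (23040 * hs * ws + 4800 * ws ^ 2) ≤ s := hmain.trans (div_le_self hs0 (by norm_num))
  have hs21 : s ≤ 1 / 10 ^ 21 := hsq.trans hq1'
  refine ⟨hθs, hθs.trans (by nlinarith only [hs0]), ?_, ?_, ?_, ?_⟩
  · nlinarith only [hmain, hhsq, hwsq, hq1', hq0, hs21, hs0]
  · nlinarith only [hθs, hs21]
  · nlinarith only [hhsq, hq1']
  · nlinarith only [hwsq, hq1']

end Summit.QuantumFields.YangMills.Theorems.HalvingHStokesRowClosureTheta
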